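import Mathlib.Analysis.Calculus.MeanValue
import Mathlib.Analysis.Calculus.Deriv.Inv
import Mathlib.Analysis.SpecialFunctions.Pow.Real
import Mathlib.Analysis.SpecialFunctions.Sqrt
import HarnessLib

/-!
# The sharp local bound for the superlinear differential inequality `y' ≤ C y^{3/2}`

Analysis/ODE proof file (theorems only). The honest content of every «energy inequality with cubic
production» argument (`ℰ' ≤ cℰ³` for the enstrophy after the change of unknown `y = ℰ²`, or
`E' + 2νD ≤ C E^{3/2}` as printed in claimed regularity proofs adjudicated by the cell `ns-claims`,
D-0090 — e.g. row C104 `Literature.Claims.NS.Silvente2025.Step_2loc`): such a law gives a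
HORIZON-DEPENDENT bound and nothing more.

* `le_div_sq_of_deriv_le_mul_sqrt` — if `y ≥ 0` is continuous on `[0,b]` with right derivatives `y'`
  on `[0,b)`, `y' ≤ C y √y` there (`C ≥ 0`), and `(C/2)·b·√(y 0) < 1`, then
  `y t ≤ y 0 / (1 − (C/2) t √(y 0))²` on `[0,b]` — the SHARP majorant (it solves `B' = C B√B`).
  Proof: Mathlib's fencing theorem `image_le_of_deriv_right_lt_deriv_boundary'` against the barriers
  `B_ε = (y₀+ε)/(1 − ((C+ε)/2) t √(y₀+ε))²`, `ε ↓ 0` (at a touching point `y' ≤ C B√B < (C+ε) B√B = B_ε'`).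
  In particular `y 0 = 0 ⇒ y ≡ 0` (no spontaneous growth from rest under this law).
* `le_div_sq_of_deriv_le_rpow` — the same with the production written `C y^{3/2}` (`Real.rpow`).
* `hasDerivAt_superlinearProfile` — sharpness: `B(t) = y₀/(1 − (C/2) t √y₀)²` satisfies `B' = C B √B`
  wherever `1 − (C/2)t√y₀ ≠ 0`, so the majorant is attained and no bound survives past
  `T* = 2/(C√y₀)` (cf. `Literature.Barriers.NavierStokesRegularity.SuperlinearVolterraNoAprioriBound` for
  the Volterra form of «no horizon-free bound»).

Standard (Bihari–LaSalle comparison): Robinson–Rodrigo–Sadowski 2016, §6.2 — the proof of Thm 6.8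
compares `‖∇u_n‖²` with the solution of `dX/dt = cX³` ((6.8), p.134) and Exercise 6.2 is exactly the
comparison principle «`X' ≤ X³`, `X(0) ≤ Y(0)` ⇒ `X ≤ Y` before `Y` blows up»; this file is the exponent
`3/2` instance with the explicit profile.
[cite: RobinsonRodrigoSadowskiCUP2016, Exercise 6.2 (Ch. 6) with the proof of Thm 6.8, (6.8), §6.2 p.133–134 (comparison with the blow-up profile of Y' = cY^p; exponent p = 3/2 here)]

WHAT THIS IS NOT: not a claim about NS regularity or blow-up; not a claim about any author beyond the
typed locator.
-/

noncomputable section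

open Set Filter Topology Real

namespace Literature.Analysis.ODE

/-- The barrier `s ↦ A / (1 − K s σ)²` has derivative `2KσA/(1 − K s σ)³` (written as the quotient-rule
expression) wherever the denominator is non-zero. [folklore] -/
private theorem hasDerivAt_barrier (A K σ s : ℝ) (hs : 1 - K * s * σ ≠ 0) :
    HasDerivAt (fun r : ℝ => A / (1 - K * r * σ) ^ 2)
      ((0 * (1 - K * s * σ) ^ 2 - A * (2 * (1 - K * s * σ) * (-(K * σ)))) / ((1 - K * s * σ) ^ 2) ^ 2)
      s := by
  have hg : HasDerivAt (fun r : ℝ => 1 - K * r * σ) (-(K * σ)) s := by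
    have h1 : HasDerivAt (fun r : ℝ => K * r * σ) (K * 1 * σ) s :=
      ((hasDerivAt_id s).const_mul K).mul_const σ
    exact ((hasDerivAt_const s (1 : ℝ)).sub h1).congr_deriv (by ring)
  have hg2 : HasDerivAt (fun r : ℝ => (1 - K * r * σ) ^ 2) (2 * (1 - K * s * σ) * (-(K * σ))) s :=
    (hg.pow 2).congr_deriv (by simp [pow_one])
  exact (hasDerivAt_const s A).div hg2 (pow_ne_zero 2 hs)

/-- **Sharp local bound for `y' ≤ C y √y`** (fencing against `(y₀+ε)/(1 − ((C+ε)/2)t√(y₀+ε))²`,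
`ε ↓ 0`): for `C ≥ 0`, `y ≥ 0` continuous on `[0,b]` with right derivatives `y'` on `[0,b)` satisfying
`y' ≤ C y √y`, and the horizon condition `(C/2)·b·√(y 0) < 1`, one has
`y t ≤ y 0 / (1 − (C/2)·t·√(y 0))²` on `[0,b]`. The majorant solves `B' = C B √B` with `B 0 = y 0`.
[cite: RobinsonRodrigoSadowskiCUP2016, Exercise 6.2 (Ch. 6) with the proof of Thm 6.8, (6.8), §6.2 p.133–134 (comparison with the blow-up profile of Y' = cY^p; exponent p = 3/2 here)] -/
theorem le_div_sq_of_deriv_le_mul_sqrt {y y' : ℝ → ℝ} {C b : ℝ} (hC : 0 ≤ C)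
    (hy : ContinuousOn y (Icc 0 b)) (hy' : ∀ t ∈ Ico 0 b, HasDerivWithinAt y (y' t) (Ici t) t)
    (hnn : ∀ t ∈ Icc 0 b, 0 ≤ y t)
    (hineq : ∀ t ∈ Ico 0 b, y' t ≤ C * y t * Real.sqrt (y t))
    (hhor : C / 2 * b * Real.sqrt (y 0) < 1) :
    ∀ t ∈ Icc 0 b, y t ≤ y 0 / (1 - C / 2 * t * Real.sqrt (y 0)) ^ 2 := by
  intro t ht
  have hb : 0 ≤ b := ht.1.trans ht.2
  have hy0 : 0 ≤ y 0 := hnn 0 ⟨le_rfl, hb⟩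
  -- the barrier inequality for every small `ε > 0`
  have hε : ∀ᶠ ε in 𝓝[>] (0 : ℝ),
      y t ≤ (y 0 + ε) / (1 - (C + ε) / 2 * t * Real.sqrt (y 0 + ε)) ^ 2 := by
    -- the horizon condition survives a small perturbation
    have hcont : ContinuousAt (fun ε : ℝ => (C + ε) / 2 * b * Real.sqrt (y 0 + ε)) 0 :=
      ((((continuous_const.add continuous_id).div_const 2).mul continuous_const).mul
        ((continuous_const.add continuous_id).sqrt)).continuousAt
    have hlt : ∀ᶠ ε in 𝓝 (0 : ℝ), (C + ε) / 2 * b * Real.sqrt (y 0 + ε) < 1 := by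
      refine hcont.eventually (gt_mem_nhds ?_)
      simpa using hhor
    have hpos : ∀ᶠ ε in 𝓝[>] (0 : ℝ), 0 < ε := eventually_mem_nhdsWithin
    filter_upwards [nhdsWithin_le_nhds hlt, hpos] with ε hε hεpos
    set K : ℝ := (C + ε) / 2 with hK
    set A : ℝ := y 0 + ε with hA
    set σ : ℝ := Real.sqrt (y 0 + ε) with hσ
    have hApos : 0 < A := by rw [hA]; linarith
    have hKpos : 0 < K := by rw [hK]; linarith
    have hσpos : 0 < σ := Real.sqrt_pos.mpr (by linarith)
    have hσsq : σ ^ 2 = A := by rw [hσ, hA, Real.sq_sqrt (by linarith)]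
    have hden : ∀ s ∈ Icc 0 b, 0 < 1 - K * s * σ := by
      intro s hs
      have h1 : K * s * σ ≤ K * b * σ := by
        have := mul_le_mul_of_nonneg_left hs.2 hKpos.le
        nlinarith [this, hσpos]
      linarith
    set B : ℝ → ℝ := fun s => A / (1 - K * s * σ) ^ 2 with hB
    set B' : ℝ → ℝ := fun s =>
      (0 * (1 - K * s * σ) ^ 2 - A * (2 * (1 - K * s * σ) * (-(K * σ)))) / ((1 - K * s * σ) ^ 2) ^ 2
      with hB'
    have hBd : ∀ s, 1 - K * s * σ ≠ 0 → HasDerivAt B (B' s) s := fun s hs =>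
      hasDerivAt_barrier A K σ s hs
    have h0 : y 0 ≤ B 0 := by
      have : B 0 = A := by simp [hB]
      rw [this, hA]
      linarith
    have hbound : ∀ s ∈ Ico 0 b, y s = B s → y' s < B' s := by
      intro s hs hEq
      have hd : 0 < 1 - K * s * σ := hden s (Ico_subset_Icc_self hs)
      set d : ℝ := 1 - K * s * σ with hd_def
      have hBs : B s = A / d ^ 2 := by simp [hB, hd_def]
      have hsq : Real.sqrt (B s) = σ / d := by
        rw [hBs, Real.sqrt_div' _ (sq_nonneg d), Real.sqrt_sq hd.le, hσ, hA]
      have h1 : y' s ≤ C * A * σ / d ^ 3 := by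
        have h := hineq s hs
        rw [hEq, hsq, hBs] at h
        calc y' s ≤ C * (A / d ^ 2) * (σ / d) := h
          _ = C * A * σ / d ^ 3 := by field_simp
      have h2 : B' s = (C + ε) * (A * σ / d ^ 3) := by
        simp only [hB']
        rw [← hd_def, hK]
        field_simp
        ring
      have h3 : 0 < A * σ / d ^ 3 := by positivity
      rw [h2]
      calc y' s ≤ C * A * σ / d ^ 3 := h1
        _ = C * (A * σ / d ^ 3) := by ring
        _ < (C + ε) * (A * σ / d ^ 3) := by nlinarith
    have key := image_le_of_deriv_right_lt_deriv_boundary' hy hy' h0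
      (fun s hs => (hBd s (hden s hs).ne').continuousAt.continuousWithinAt)
      (fun s hs => (hBd s (hden s (Ico_subset_Icc_self hs)).ne').hasDerivWithinAt) hbound ht
    simpa [hB, hA, hK, hσ] using key
  -- let `ε → 0⁺`
  have hd0 : 0 < 1 - C / 2 * t * Real.sqrt (y 0) := by
    have h1 : C / 2 * t * Real.sqrt (y 0) ≤ C / 2 * b * Real.sqrt (y 0) := by
      have := mul_le_mul_of_nonneg_left ht.2 (by positivity : 0 ≤ C / 2)
      exact mul_le_mul_of_nonneg_right this (Real.sqrt_nonneg _)
    linarith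
  have hcont : ContinuousAt
      (fun ε : ℝ => (y 0 + ε) / (1 - (C + ε) / 2 * t * Real.sqrt (y 0 + ε)) ^ 2) 0 := by
    refine ContinuousAt.div (by fun_prop) ?_ ?_
    · exact ((continuous_const.sub ((((continuous_const.add continuous_id).div_const 2).mul
        continuous_const).mul ((continuous_const.add continuous_id).sqrt))).pow 2).continuousAt
    · simpa using hd0.ne'
  have hlim : Tendsto (fun ε : ℝ => (y 0 + ε) / (1 - (C + ε) / 2 * t * Real.sqrt (y 0 + ε)) ^ 2)
      (𝓝[>] (0 : ℝ)) (𝓝 (y 0 / (1 - C / 2 * t * Real.sqrt (y 0)) ^ 2)) := by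
    have h := hcont.tendsto
    simp only [add_zero] at h
    exact h.mono_left nhdsWithin_le_nhds
  exact ge_of_tendsto hlim hε

/-- The same with the production term written as `C y^{3/2}` (`Real.rpow`).
[cite: RobinsonRodrigoSadowskiCUP2016, Exercise 6.2 (Ch. 6) with the proof of Thm 6.8, (6.8), §6.2 p.133–134 (comparison with the blow-up profile of Y' = cY^p; exponent p = 3/2 here)] -/
theorem le_div_sq_of_deriv_le_rpow {y y' : ℝ → ℝ} {C b : ℝ} (hC : 0 ≤ C)
    (hy : ContinuousOn y (Icc 0 b)) (hy' : ∀ t ∈ Ico 0 b, HasDerivWithinAt y (y' t) (Ici t) t)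
    (hnn : ∀ t ∈ Icc 0 b, 0 ≤ y t)
    (hineq : ∀ t ∈ Ico 0 b, y' t ≤ C * y t ^ (3 / 2 : ℝ))
    (hhor : C / 2 * b * Real.sqrt (y 0) < 1) :
    ∀ t ∈ Icc 0 b, y t ≤ y 0 / (1 - C / 2 * t * Real.sqrt (y 0)) ^ 2 := by
  refine le_div_sq_of_deriv_le_mul_sqrt hC hy hy' hnn (fun t ht => ?_) hhor
  have h0 : 0 ≤ y t := hnn t (Ico_subset_Icc_self ht)
  have h32 : y t ^ (3 / 2 : ℝ) = y t * Real.sqrt (y t) := by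
    rw [Real.sqrt_eq_rpow, show (3 / 2 : ℝ) = 1 + 1 / 2 by norm_num,
      Real.rpow_add' h0 (by norm_num), Real.rpow_one]
  have := hineq t ht
  rw [h32] at this
  linarith

/-- **No growth from rest**: under `y' ≤ C y √y` with `y ≥ 0`, `y 0 = 0` forces `y ≡ 0` on `[0,b]`
(the majorant vanishes identically). [cite: RobinsonRodrigoSadowskiCUP2016, Exercise 6.2 (Ch. 6) with the proof of Thm 6.8, (6.8), §6.2 p.133–134 (comparison with the blow-up profile of Y' = cY^p; exponent p = 3/2 here)] -/
theorem eq_zero_of_deriv_le_mul_sqrt_of_zero {y y' : ℝ → ℝ} {C b : ℝ} (hC : 0 ≤ C)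
    (hy : ContinuousOn y (Icc 0 b)) (hy' : ∀ t ∈ Ico 0 b, HasDerivWithinAt y (y' t) (Ici t) t)
    (hnn : ∀ t ∈ Icc 0 b, 0 ≤ y t)
    (hineq : ∀ t ∈ Ico 0 b, y' t ≤ C * y t * Real.sqrt (y t)) (h0 : y 0 = 0) :
    ∀ t ∈ Icc 0 b, y t = 0 := by
  intro t ht
  have h := le_div_sq_of_deriv_le_mul_sqrt hC hy hy' hnn hineq (by rw [h0]; simp) t ht
  rw [h0, zero_div] at h
  exact le_antisymm h (hnn t ht)

/-- **Sharpness**: the majorant `B(t) = y₀/(1 − (C/2) t √y₀)²` (`y₀ ≥ 0`) solves the equality case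
`B' = C B √B` wherever `1 − (C/2) t √y₀ > 0`; it blows up as `t ↑ 2/(C√y₀)` when `C, y₀ > 0`, so no
bound on `y' ≤ C y √y` survives past that horizon (the `Y` of RRS Exercise 6.2 at exponent `3/2`).
[cite: RobinsonRodrigoSadowskiCUP2016, Exercise 6.2 (Ch. 6) with the proof of Thm 6.8, (6.8), §6.2 p.133–134 (comparison with the blow-up profile of Y' = cY^p; exponent p = 3/2 here)] -/
theorem hasDerivAt_superlinearProfile {C y₀ t : ℝ} (hy₀ : 0 ≤ y₀)
    (ht : 0 < 1 - C / 2 * t * Real.sqrt y₀) :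
    HasDerivAt (fun s : ℝ => y₀ / (1 - C / 2 * s * Real.sqrt y₀) ^ 2)
      (C * (y₀ / (1 - C / 2 * t * Real.sqrt y₀) ^ 2) *
        Real.sqrt (y₀ / (1 - C / 2 * t * Real.sqrt y₀) ^ 2)) t := by
  have h := hasDerivAt_barrier y₀ (C / 2) (Real.sqrt y₀) t ht.ne'
  refine h.congr_deriv ?_
  set d : ℝ := 1 - C / 2 * t * Real.sqrt y₀ with hd
  have hsq : Real.sqrt (y₀ / d ^ 2) = Real.sqrt y₀ / d := by
    rw [Real.sqrt_div' _ (sq_nonneg d), Real.sqrt_sq ht.le]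
  rw [hsq]
  have hσ : Real.sqrt y₀ ^ 2 = y₀ := Real.sq_sqrt hy₀
  field_simp
  ring

/-- The majorant is unbounded at the horizon: for `C, y₀ > 0` and every `M`, some `t ∈ [0, 2/(C√y₀))`
has `y₀/(1 − (C/2)t√y₀)² > M` («before Y blows up», RRS Exercise 6.2).
[cite: RobinsonRodrigoSadowskiCUP2016, Exercise 6.2 (Ch. 6) with the proof of Thm 6.8, (6.8), §6.2 p.133–134 (comparison with the blow-up profile of Y' = cY^p; exponent p = 3/2 here)] -/
theorem superlinearProfile_unbounded {C y₀ : ℝ} (hC : 0 < C) (hy₀ : 0 < y₀) (M : ℝ) :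
    ∃ t : ℝ, 0 ≤ t ∧ t < 2 / (C * Real.sqrt y₀) ∧ M < y₀ / (1 - C / 2 * t * Real.sqrt y₀) ^ 2 := by
  have hσ : 0 < Real.sqrt y₀ := Real.sqrt_pos.mpr hy₀
  have hT : 0 < 2 / (C * Real.sqrt y₀) := by positivity
  -- choose `t` with `1 - (C/2) t √y₀ = δ`, `δ` small: `t = (1 - δ) · 2/(C√y₀)`
  obtain ⟨δ, hδpos, hδlt1, hδM⟩ : ∃ δ : ℝ, 0 < δ ∧ δ < 1 ∧ M < y₀ / δ ^ 2 := by
    by_cases hM : M ≤ 0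
    · exact ⟨1 / 2, by norm_num, by norm_num, hM.trans_lt (by positivity)⟩
    · push Not at hM
      refine ⟨min (1 / 2) (Real.sqrt (y₀ / (2 * M))), ?_, ?_, ?_⟩
      · exact lt_min (by norm_num) (Real.sqrt_pos.mpr (by positivity))
      · exact (min_le_left _ _).trans_lt (by norm_num)
      · have hle : min (1 / 2) (Real.sqrt (y₀ / (2 * M))) ≤ Real.sqrt (y₀ / (2 * M)) := min_le_right _ _
        have hmpos : 0 < min (1 / 2) (Real.sqrt (y₀ / (2 * M))) :=
          lt_min (by norm_num) (Real.sqrt_pos.mpr (by positivity))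
        have hsq : (min (1 / 2) (Real.sqrt (y₀ / (2 * M)))) ^ 2 ≤ y₀ / (2 * M) := by
          calc (min (1 / 2) (Real.sqrt (y₀ / (2 * M)))) ^ 2 ≤ (Real.sqrt (y₀ / (2 * M))) ^ 2 := by
                gcongr
            _ = y₀ / (2 * M) := Real.sq_sqrt (by positivity)
        rw [lt_div_iff₀ (by positivity)]
        calc M * (min (1 / 2) (Real.sqrt (y₀ / (2 * M)))) ^ 2 ≤ M * (y₀ / (2 * M)) := by gcongr
          _ = y₀ / 2 := by field_simp
          _ < y₀ := by linarith
  refine ⟨(1 - δ) * (2 / (C * Real.sqrt y₀)), by positivity, ?_, ?_⟩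
  · calc (1 - δ) * (2 / (C * Real.sqrt y₀)) < 1 * (2 / (C * Real.sqrt y₀)) := by gcongr; linarith
      _ = 2 / (C * Real.sqrt y₀) := one_mul _
  · have hd : 1 - C / 2 * ((1 - δ) * (2 / (C * Real.sqrt y₀))) * Real.sqrt y₀ = δ := by
      field_simp
      ring
    rw [hd]
    exact hδM

end Literature.Analysis.ODE

end
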